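/-
Origin: expansion seat `prover-pub-hodgecm-mc-carch-1-g37-0`, handover #CA70 2026-08-21T03:19Z md5 61642070da3e (395 l.; NEW additive leaf; imports #CA69 Model.ArchKTypeOfCentralWeight (this kit); ns HodgeCM.Model.ArchSideTerm; 12 theorems 0 defs; NAMES for audit: HodgeCM.Model.ArchSideTerm.lineCharV_zero_center_mul_lineC · HodgeCM.Model.ArchSideTerm.w_mul_lineCharV_zero_eq_torusScalar_of_eq_blockFamilyOfAt · HodgeCM.Model.ArchSideTerm.w_mul_lineCharV_one_eq_torusScalar_of_eq_blockFamilyOfAt) (`HOME/mc/pub-hodgecm-mc-carch-1/stage71/HodgeCM/Model/ArchKTypeOfCentralWeightPin.lean`, md5 61642070da3e, 395 lines);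
landed by the gen-30 packager (p-g30) in gate run 71 as `HodgeCM/Model/ArchKTypeOfCentralWeightPin.lean` (verbatim).
-/
/-
Copyright (c) 2026. Released under Apache 2.0 license as described in the file LICENSE.
Cell pub-hodgecm, MODEL layer (construction prover mc-carch-1, gen 37), row-9 (J-Liu-Θ) junction: (CF_k) ∕ (Hw_k′) DISCHARGED for the honest
harmonic datum of slots 0 and 1 (sinst-1-g11 SEAM NOTE 2026-08-21 (Hw_k); binder-1 #R125 pin currency `hemb eR eS hχ a hω hdef`).
-/
import Summits.HodgeConjecture.HodgeCM.Model.ArchKTypeOfCentralWeight_2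

/-!
# `w_k · s_k(centre) = torusScalar_k` AT THE HONEST HARMONIC DATUM (slots 0, 1)

`Model/ArchKTypeOfCentralWeight` reduces sinst-1's archimedean identity (Hw_k′) `w t · lineCharV_k (u_t · 1_V) = torusScalar_k (u_t)` of an
archimedean input `A : ArchLineInput V (lineRepOf … k)` to (CF_k): the archimedean CENTRE in the `U(V)`-slot of the twisted line kernel fixes the
pinned vector.  Here (CF_k) is PROVED, `k = 0, 1`, for the honest harmonic slot family
`Φ_∞,k(ℓ) := blockFamilyOfAt … eR eS (degOnePDual Empty) (binvPi 1) ℓ` (#CA13) from EXACTLY binder-1's pin hypotheses (#R125 `pinDatumZero/One`):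

* away from `w(ι₁)`: the away factor `centerAway V t` (trivial at `w(ι₁)`) acts trivially under `c_k • ω_∞,k` by (c5) — #CA61's `hω` (exponent table)
  and `hdef` (definite type of the line scalar) through #CA20's place induction `smul_apply_eq_self_of_places`
  (`archScalar_kG_smul_centerAway_blockFamilyOfAt`);
* at `w(ι₁)`: the `ι₁`-section factor at the CENTRAL `z_t · 1 ∈ K` acts through `lineOmega_k` by `τ₁^∨(z_t · 1) = id` — carch's `harm_lineOmega_kG`
  (`hemb eR eS hχ`) + `weightOf_dual_blockK_centralK` (`lineScalar_k_smul_centerK_blockFamilyOfAt`);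
* assembled: **`lineCharV_k_smul_cmArchCenter_blockFamilyOfAt`** ((CF_k) on `𝒮((L⁺ ⊗ ℝ)³)`), **`lineCharV_k_smul_cmPairRep_center_testFun`**
  ((CF_k) on every `φ_N`, the hypothesis `hfix` of `w_mul_lineCharV_k_eq_torusScalar`), and
  **`w_mul_lineCharV_k_eq_torusScalar_of_eq_blockFamilyOfAt`**: (Hw_k′) for ANY four `η`'s / conjugated-plane splittings and ANY
  `A : ArchLineInput V (lineRepOf … k)` with `A.Φinf = Φ_∞,k(ℓ₀)`.

Reading for the consumers (sinst-1 #1260/#1261, the slot-assembly leaf): at `η₀ := eta₀ V c.D η` (`archSideOf`) `lineCharV_zero … (eta₀ V c.D η)` is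
#1256's `adelicCharZero V c hGR hGR₀ hGR₁ η` (same term), so slot 0's `hw` of `hasRationalRestriction_charZeroDict_one_of_weight` is
`w_mul_lineCharV_zero_eq_torusScalar_of_eq_blockFamilyOfAt` at `w := (A 0).w` (`archSideOf_P_w` rfl); slot 1's UNTWISTED `hw` is the case
`lineCharV_one = 1` (default split, #CA21), and at the ν-twisted pins of record `lineCharV_one … (etaT₁ V c.D η ν) = ν` is the twist the slot-1
dictionary record must carry (sinst-1's #1256 pattern).  Slots 2, 3 (conjugated plane, #CA66's `harm_lineOmega_two/threeG`) follow the same template.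
Nothing is cited and nothing is minted: kernel lemmas over installed carch modules; 0 records, 0 `def … : Prop`.
-/

set_option autoImplicit false

noncomputable section

open NumberField NumberField.InfinitePlace NumberField.mixedEmbedding IsDedekindDomain
open scoped Matrix TensorProduct Classical SchwartzMap
open MulAction
open Literature.Geometry.ComplexHyperbolic.BallModel (U21 x₀ stabilizerEquivK21 blockK blockU bmat mat_blockU)
open Literature.NumberTheory.Automorphic.U21 (K21 matA sclD)
open Literature.AlgebraicGeometry.ShimuraVarieties Literature.AlgebraicGeometry.ShimuraVarieties.BallForms
open Literature.NumberTheory.Automorphic Literature.NumberTheory.Automorphic.UnitaryGroup Literature.NumberTheory.Weil1964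
open Literature.RepresentationTheory.KonnoKonno2007 Literature.RepresentationTheory.KonnoKonno2007.RealDualPair
open Literature.NumberTheory.GelbartRogawski1991 Literature.NumberTheory.GelbartRogawski1991.UnitaryDualPair
open Literature.Analysis.SegalBargmann
open HodgeCM.Adelic HodgeCM.PerL34 HodgeCM.Model.HypCensus HodgeCM.Model.SupplyInstance

namespace HodgeCM.Model.ArchSideTerm

/-! #### § 3d. (CF₀), (CF₁) for the honest harmonic datum, from `hemb eR eS hχ a hω hdef` (binder-1's #R125 currency) -/

section Honest

variable {L : CMField} {ι₁ : L →+* ℂ} (V : HermSpace3 L ι₁) (c : SeesawCtx L)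
variable
  (hGR : (cmSplittingDatum (L : Type) finProdFinEquiv (frameD V) (frameD_real V) (frameD_ne V) (dW c.D) (dW_real c.D)
    (dW_ne c.D)).CompatibleSplitting)
  (hGR₀ : (cmSplittingDatum (L : Type) (e₁) (frameD V) (frameD_real V) (frameD_ne V) (lineVec (L : Type) (dW c.D 0))
    (fun _ => dW_real c.D 0) (fun _ => dW_ne c.D 0)).CompatibleSplitting)
  (hGR₁ : (cmSplittingDatum (L : Type) (e₁) (frameD V) (frameD_real V) (frameD_ne V) (lineVec (L : Type) (dW c.D 1))
    (fun _ => dW_real c.D 1) (fun _ => dW_ne c.D 1)).CompatibleSplitting)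
  (η₀ η₁ : CMAdelic (L : Type) (frameD V) × CMAdelicOne (L : Type) →* ℂˣ)
  (h₁W : (∀ j, 0 < (ι₁ (dW c.D j)).re) ∨ ∀ j, (ι₁ (dW c.D j)).re < 0)
  (hemb : (InfinitePlace.mk ι₁).embedding = ι₁)

/-! ##### slot 0 -/

section Zero

variable
  (eR : PosIdx (cmXW (L : Type) (frameD V) (lineVec (L : Type) (dW c.D 0)) (fun _ => dW_real c.D 0) ι₁ (HypCensus.cmPlace (L : Type) ι₁)) ≃ Unit)
  (eS : NegIdx (cmXW (L : Type) (frameD V) (lineVec (L : Type) (dW c.D 0)) (fun _ => dW_real c.D 0) ι₁ (HypCensus.cmPlace (L : Type) ι₁)) ≃ Empty)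
  (hχ : ∀ u : stabilizer U21 x₀,
    ((lineScalar_zero V c.D hGR hGR₀ hGR₁ η₀ (u : U21) : ℂˣ) : ℂ) *
        ((matA (stabilizerEquivK21.symm u)).det ^ (lineVacExponentsZero V c hGR₀ h₁W eR eS).eP *
          sclD (stabilizerEquivK21.symm u) ^ (lineVacExponentsZero V c hGR₀ h₁W eR eS).eQ) =
      star (sclD (stabilizerEquivK21.symm u)))
  (a : {v : InfinitePlace ↥(maximalRealSubfield L) // v.IsReal} → ℤ)
  (hω : ∀ b : {v : InfinitePlace ↥(maximalRealSubfield L) // v.IsReal}, b ≠ HypCensus.cmPlace (L : Type) ι₁ →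
    ∀ (u : UnitaryGroup.archLocal (L : Type) 3 (Matrix.diagonal (frameD V)) (cmPlaceOver (L : Type) b)) (ℓ : Module.Dual ℂ (Fin 2 → ℂ)),
      cmArchWeilRep (L : Type) e₁ (frameD V) (frameD_real V) (frameD_ne V) (lineVec (L : Type) (dW c.D 0)) (fun _ => dW_real c.D 0)
          (fun _ => dW_ne c.D 0) hGR₀
          (UnitaryGroup.archSingle (↥(maximalRealSubfield L)) L (IsCMField.complexConj L) 3 (Matrix.diagonal (frameD V))
            (IsCMField.complexConj_ne_one L) (NumberField.complexConj_smul_infinitePlace (L : Type)) (cmPlaceOver (L : Type) b) u, 1)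
          (blockFamilyOfAt (L : Type) e₁ (frameD V) (frameD_real V) (frameD_ne V) (lineVec (L : Type) (dW c.D 0)) (fun _ => dW_real c.D 0)
            (fun _ => dW_ne c.D 0) ι₁ (blockPosEquiv V) (blockNegEquiv V) eR eS (degOnePDual Empty) (binvPi 1) ℓ) =
        (((u : UnitaryGroup.archLocal (L : Type) 3 (Matrix.diagonal (frameD V)) (cmPlaceOver (L : Type) b)) : GL (Fin 3) ℂ) :
            Matrix (Fin 3) (Fin 3) ℂ).det ^ a b •
          blockFamilyOfAt (L : Type) e₁ (frameD V) (frameD_real V) (frameD_ne V) (lineVec (L : Type) (dW c.D 0)) (fun _ => dW_real c.D 0)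
            (fun _ => dW_ne c.D 0) ι₁ (blockPosEquiv V) (blockNegEquiv V) eR eS (degOnePDual Empty) (binvPi 1) ℓ)
  (hdef : ∀ b : {v : InfinitePlace ↥(maximalRealSubfield L) // v.IsReal}, b ≠ HypCensus.cmPlace (L : Type) ι₁ →
    ∀ u : UnitaryGroup.archLocal (L : Type) 3 (Matrix.diagonal (frameD V)) (cmPlaceOver (L : Type) b),
      ((archScalar_zeroG V c.D hGR hGR₀ hGR₁ η₀
          (UnitaryGroup.archSingle (↥(maximalRealSubfield L)) L (IsCMField.complexConj L) 3 (Matrix.diagonal (frameD V))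
            (IsCMField.complexConj_ne_one L) (NumberField.complexConj_smul_infinitePlace (L : Type)) (cmPlaceOver (L : Type) b) u) : ℂˣ) : ℂ) *
        (((u : UnitaryGroup.archLocal (L : Type) 3 (Matrix.diagonal (frameD V)) (cmPlaceOver (L : Type) b)) : GL (Fin 3) ℂ) :
            Matrix (Fin 3) (Fin 3) ℂ).det ^ a b = 1)

include hω hdef in
/-- the AWAY factor of the centre fixes every member of the line-0 slot family under `c₀ • ω_∞,0` ((c5), #CA20's place induction). -/
theorem archScalar_zeroG_smul_centerAway_blockFamilyOfAt
    (t : ↥(Literature.NumberTheory.Automorphic.relNormOneInfUnits (↥(maximalRealSubfield L)) L)) (ℓ : Module.Dual ℂ (Fin 2 → ℂ)) :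
    ((archScalar_zeroG V c.D hGR hGR₀ hGR₁ η₀ (centerAway V t) : ℂˣ) : ℂ) •
        cmArchWeilRep (L : Type) e₁ (frameD V) (frameD_real V) (frameD_ne V) (lineVec (L : Type) (dW c.D 0)) (fun _ => dW_real c.D 0)
          (fun _ => dW_ne c.D 0) hGR₀ (centerAway V t, 1)
          (blockFamilyOfAt (L : Type) e₁ (frameD V) (frameD_real V) (frameD_ne V) (lineVec (L : Type) (dW c.D 0)) (fun _ => dW_real c.D 0)
            (fun _ => dW_ne c.D 0) ι₁ (blockPosEquiv V) (blockNegEquiv V) eR eS (degOnePDual Empty) (binvPi 1) ℓ) =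
      blockFamilyOfAt (L : Type) e₁ (frameD V) (frameD_real V) (frameD_ne V) (lineVec (L : Type) (dW c.D 0)) (fun _ => dW_real c.D 0)
        (fun _ => dW_ne c.D 0) ι₁ (blockPosEquiv V) (blockNegEquiv V) eR eS (degOnePDual Empty) (binvPi 1) ℓ := by
  have h := smul_apply_eq_self_of_places (L : Type) (Matrix.diagonal (frameD V))
    ((cmArchWeilRep (L : Type) e₁ (frameD V) (frameD_real V) (frameD_ne V) (lineVec (L : Type) (dW c.D 0)) (fun _ => dW_real c.D 0)
      (fun _ => dW_ne c.D 0) hGR₀).comp (MonoidHom.inl _ _))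
    (archScalar_zeroG V c.D hGR hGR₀ hGR₁ η₀)
    (blockFamilyOfAt (L : Type) e₁ (frameD V) (frameD_real V) (frameD_ne V) (lineVec (L : Type) (dW c.D 0)) (fun _ => dW_real c.D 0)
      (fun _ => dW_ne c.D 0) ι₁ (blockPosEquiv V) (blockNegEquiv V) eR eS (degOnePDual Empty) (binvPi 1) ℓ)
    (UnitaryGroup.cmPlace (L : Type) ι₁) (fun b hb u => by
      rw [MonoidHom.comp_apply, MonoidHom.inl_apply, hω b (ne_cmPlace_of_cmPlaceOver_ne hb) u ℓ, smul_smul,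
        hdef b (ne_cmPlace_of_cmPlaceOver_ne hb) u, one_smul])
    (centerAway V t) (archAt_centerAway V t)
  rw [MonoidHom.comp_apply, MonoidHom.inl_apply] at h
  exact h

include hemb hχ in
/-- the `ι₁`-SECTION factor of the centre fixes every member of the line-0 slot family under `c₀ • ω_∞,0` (`harm` at the CENTRAL element
`z_t · 1 ∈ K`, `τ₁^∨(z · 1) = id`). -/
theorem lineScalar_zero_smul_centerK_blockFamilyOfAt
    (t : ↥(Literature.NumberTheory.Automorphic.relNormOneInfUnits (↥(maximalRealSubfield L)) L)) (ℓ : Module.Dual ℂ (Fin 2 → ℂ)) :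
    ((lineScalar_zero V c.D hGR hGR₀ hGR₁ η₀ ((centerK (L : Type) ι₁ t : stabilizer U21 x₀) : U21) : ℂˣ) : ℂ) •
        cmArchWeilRep (L : Type) e₁ (frameD V) (frameD_real V) (frameD_ne V) (lineVec (L : Type) (dW c.D 0)) (fun _ => dW_real c.D 0)
          (fun _ => dW_ne c.D 0) hGR₀ (archSectionFrameOf V ((centerK (L : Type) ι₁ t : stabilizer U21 x₀) : U21), 1)
          (blockFamilyOfAt (L : Type) e₁ (frameD V) (frameD_real V) (frameD_ne V) (lineVec (L : Type) (dW c.D 0)) (fun _ => dW_real c.D 0)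
            (fun _ => dW_ne c.D 0) ι₁ (blockPosEquiv V) (blockNegEquiv V) eR eS (degOnePDual Empty) (binvPi 1) ℓ) =
      blockFamilyOfAt (L : Type) e₁ (frameD V) (frameD_real V) (frameD_ne V) (lineVec (L : Type) (dW c.D 0)) (fun _ => dW_real c.D 0)
        (fun _ => dW_ne c.D 0) ι₁ (blockPosEquiv V) (blockNegEquiv V) eR eS (degOnePDual Empty) (binvPi 1) ℓ := by
  have hv := harm_lineOmega_zeroG V c hGR hGR₀ hGR₁ η₀ h₁W (binvPi 1) hemb eR eS hχ (centerK (L : Type) ι₁ t) ℓ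
  rw [centerK_def, weightOf_dual_blockK_centralK, ← centerK_def, lineOmega_zero, Representation.smulPull_apply] at hv
  exact hv

include hemb hχ hω hdef in
/-- **(CF₀) on the slot family**: the archimedean CENTRE `t · 1_V` in the `U(V)`-slot of line 0 fixes every member `Φ_∞,0(ℓ)`:
`lineCharV_0(u_t · 1_V) • ω_∞,0(t · 1₃, 1) Φ_∞,0(ℓ) = Φ_∞,0(ℓ)`. -/
theorem lineCharV_zero_smul_cmArchCenter_blockFamilyOfAt
    (t : ↥(Literature.NumberTheory.Automorphic.relNormOneInfUnits (↥(maximalRealSubfield L)) L)) (ℓ : Module.Dual ℂ (Fin 2 → ℂ)) :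
    ((lineCharV_zero V c.D hGR hGR₀ hGR₁ η₀ (CMCenter (L : Type) (frameD V) ((UnitaryGroup.cmAdelicOneEquivRelNormOne (L : Type)).symm
        (Literature.NumberTheory.Automorphic.relNormOneInfToIdeles (↥(maximalRealSubfield L)) L t))) : ℂˣ) : ℂ) •
        cmArchWeilRep (L : Type) e₁ (frameD V) (frameD_real V) (frameD_ne V) (lineVec (L : Type) (dW c.D 0)) (fun _ => dW_real c.D 0)
          (fun _ => dW_ne c.D 0) hGR₀ (cmArchCenter (L : Type) 3 (Matrix.diagonal (frameD V)) t, 1)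
          (blockFamilyOfAt (L : Type) e₁ (frameD V) (frameD_real V) (frameD_ne V) (lineVec (L : Type) (dW c.D 0)) (fun _ => dW_real c.D 0)
            (fun _ => dW_ne c.D 0) ι₁ (blockPosEquiv V) (blockNegEquiv V) eR eS (degOnePDual Empty) (binvPi 1) ℓ) =
      blockFamilyOfAt (L : Type) e₁ (frameD V) (frameD_real V) (frameD_ne V) (lineVec (L : Type) (dW c.D 0)) (fun _ => dW_real c.D 0)
        (fun _ => dW_ne c.D 0) ι₁ (blockPosEquiv V) (blockNegEquiv V) eR eS (degOnePDual Empty) (binvPi 1) ℓ := by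
  rw [← archToAdelic_cmArchCenter_frameD, ← archScalar_zeroG_eq_lineCharV, cmArchCenter_eq_archSectionFrameOf_mul_centerAway V t,
    map_mul, Units.val_mul,
    show ((archSectionFrameOf V ((centerK (L : Type) ι₁ t : stabilizer U21 x₀) : U21) * centerAway V t,
        (1 : UnitaryGroup.arch (↥(maximalRealSubfield L)) L (IsCMField.complexConj L) 1 (Matrix.diagonal (lineVec (L : Type) (dW c.D 0))))) :
        UnitaryGroup.arch (↥(maximalRealSubfield L)) L (IsCMField.complexConj L) 3 (Matrix.diagonal (frameD V)) ×
          UnitaryGroup.arch (↥(maximalRealSubfield L)) L (IsCMField.complexConj L) 1 (Matrix.diagonal (lineVec (L : Type) (dW c.D 0)))) =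
      (archSectionFrameOf V ((centerK (L : Type) ι₁ t : stabilizer U21 x₀) : U21), 1) * (centerAway V t, 1) by rw [Prod.mk_mul_mk, mul_one],
    map_mul, Module.End.mul_apply, mul_smul, ← map_smul, archScalar_zeroG_smul_centerAway_blockFamilyOfAt V c hGR hGR₀ hGR₁ η₀ eR eS a hω hdef]
  exact lineScalar_zero_smul_centerK_blockFamilyOfAt V c hGR hGR₀ hGR₁ η₀ h₁W hemb eR eS hχ t ℓ

include hemb hχ hω hdef in
/-- **(CF₀) on thin-coset test functions**: `lineCharV_0(u_t·1_V) • ω₀(u_t·1_V, 1) φ_N(Φ_∞,0(ℓ)) = φ_N(Φ_∞,0(ℓ))` at every base point and level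
(the hypothesis `hfix` of `w_mul_lineCharV_zero_eq_torusScalar`, DISCHARGED for the harmonic family). -/
theorem lineCharV_zero_smul_cmPairRep_center_testFun
    (t : ↥(Literature.NumberTheory.Automorphic.relNormOneInfUnits (↥(maximalRealSubfield L)) L)) (ℓ : Module.Dual ℂ (Fin 2 → ℂ))
    (x : Fin 3 → ↥(maximalRealSubfield L)) (N : ℕ) :
    ((lineCharV_zero V c.D hGR hGR₀ hGR₁ η₀ (CMCenter (L : Type) (frameD V) ((UnitaryGroup.cmAdelicOneEquivRelNormOne (L : Type)).symm
        (Literature.NumberTheory.Automorphic.relNormOneInfToIdeles (↥(maximalRealSubfield L)) L t))) : ℂˣ) : ℂ) •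
        cmPairRep (L : Type) e₁ (frameD V) (frameD_real V) (frameD_ne V) (lineVec (L : Type) (dW c.D 0)) (fun _ => dW_real c.D 0)
          (fun _ => dW_ne c.D 0) hGR₀
          (CMCenter (L : Type) (frameD V) ((UnitaryGroup.cmAdelicOneEquivRelNormOne (L : Type)).symm
            (Literature.NumberTheory.Automorphic.relNormOneInfToIdeles (↥(maximalRealSubfield L)) L t)), 1)
          (SupplyInstance.testFun (↥(maximalRealSubfield L)) (Fin 3)
            (blockFamilyOfAt (L : Type) e₁ (frameD V) (frameD_real V) (frameD_ne V) (lineVec (L : Type) (dW c.D 0)) (fun _ => dW_real c.D 0)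
              (fun _ => dW_ne c.D 0) ι₁ (blockPosEquiv V) (blockNegEquiv V) eR eS (degOnePDual Empty) (binvPi 1) ℓ) x N) =
      SupplyInstance.testFun (↥(maximalRealSubfield L)) (Fin 3)
        (blockFamilyOfAt (L : Type) e₁ (frameD V) (frameD_real V) (frameD_ne V) (lineVec (L : Type) (dW c.D 0)) (fun _ => dW_real c.D 0)
          (fun _ => dW_ne c.D 0) ι₁ (blockPosEquiv V) (blockNegEquiv V) eR eS (degOnePDual Empty) (binvPi 1) ℓ) x N := by
  rw [cmPairRep_cmCenter_inf_one_testFun, ← testFun_smul,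
    lineCharV_zero_smul_cmArchCenter_blockFamilyOfAt V c hGR hGR₀ hGR₁ η₀ h₁W hemb eR eS hχ a hω hdef]

include hemb hχ hω hdef in
/-- **(Hw₀′) DISCHARGED for an archimedean input pinned on the harmonic family**: for ANY four `η`'s, ANY conjugated-plane splittings and
ANY `A : ArchLineInput V (lineRepOf … 0)` with `A.Φinf = Φ_∞,0(ℓ₀)`:  `A.w t · lineCharV_0 (u_t · 1_V) = torusScalar_0 (u_t)` for every `t`.
At `η₀ := eta₀ V c.D η` (period-1's default split, `archSideOf`) `lineCharV_zero … (eta₀ V c.D η)` is sinst-1's `adelicCharZero V c hGR hGR₀ hGR₁ η`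
on the nose (same term), so this is the hypothesis `hw` of #1261 `hasRationalRestriction_charZeroDict_one_of_weight` at `w := A.w`. -/
theorem w_mul_lineCharV_zero_eq_torusScalar_of_eq_blockFamilyOfAt
    (hGR₂ : (cmSplittingDatum (L : Type) (e₁) (frameD V) (frameD_real V) (frameD_ne V) (lineVec (L : Type) (dW' c.D 0))
      (fun _ => dW'_real c.D 0) (fun _ => dW'_ne c.D 0)).CompatibleSplitting)
    (hGR₃ : (cmSplittingDatum (L : Type) (e₁) (frameD V) (frameD_real V) (frameD_ne V) (lineVec (L : Type) (dW' c.D 1))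
      (fun _ => dW'_real c.D 1) (fun _ => dW'_ne c.D 1)).CompatibleSplitting)
    (η₂ η₃ : CMAdelic (L : Type) (frameD V) × CMAdelicOne (L : Type) →* ℂˣ)
    (A : ArchLineInput V (lineRepOf V c.D hGR hGR₀ hGR₁ hGR₂ hGR₃ η₀ η₁ η₂ η₃ 0)) {ℓ₀ : Module.Dual ℂ (Fin 2 → ℂ)}
    (hΦ : A.Φinf = blockFamilyOfAt (L : Type) e₁ (frameD V) (frameD_real V) (frameD_ne V) (lineVec (L : Type) (dW c.D 0)) (fun _ => dW_real c.D 0)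
      (fun _ => dW_ne c.D 0) ι₁ (blockPosEquiv V) (blockNegEquiv V) eR eS (degOnePDual Empty) (binvPi 1) ℓ₀)
    (t : ↥(Literature.NumberTheory.Automorphic.relNormOneInfUnits (↥(maximalRealSubfield L)) L)) :
    A.w t * ((lineCharV_zero V c.D hGR hGR₀ hGR₁ η₀ (CMCenter (L : Type) (frameD V)
          ((UnitaryGroup.cmAdelicOneEquivRelNormOne (L : Type)).symm
            (Literature.NumberTheory.Automorphic.relNormOneInfToIdeles (↥(maximalRealSubfield L)) L t))) : ℂˣ) : ℂ) =
      ((torusScalar_zeroG V c.D hGR hGR₀ hGR₁ η₀ ((UnitaryGroup.cmAdelicOneEquivRelNormOne (L : Type)).symm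
            (Literature.NumberTheory.Automorphic.relNormOneInfToIdeles (↥(maximalRealSubfield L)) L t)) : ℂˣ) : ℂ) :=
  by
  have hfix := lineCharV_zero_smul_cmPairRep_center_testFun V c hGR hGR₀ hGR₁ η₀ h₁W hemb eR eS hχ a hω hdef t ℓ₀ A.x₀ 1
  rw [← hΦ] at hfix
  exact w_mul_lineCharV_zero_eq_torusScalar V c.D hGR hGR₀ hGR₁ hGR₂ hGR₃ η₀ η₁ η₂ η₃ A t one_ne_zero hfix

include hemb hχ hω hdef in
/-- **(CC₀) the character identity of the centre**: `lineCharV_0(u_t · 1_V) · c₀(t) = 1` with theta-3's centre eigenvalue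
`c₀ = lineC … hGR₀ = lineCenterChar · archPlaceChar_(w(ι₁))` (#CA60 `cmArchWeilRep_center_blockFamilyOfAt`): on the archimedean centre the
`V`-twist of line 0 is the INVERSE of the central character of the untwisted `ω_∞,0` on the harmonic vector — the one sentence behind BOTH the
index-side `hμ` (theta-3's `centralTypeOf` ∕ #S19 `centerCharInf`) and the automorphy-side `hw` ((Hw₀′)). -/
theorem lineCharV_zero_center_mul_lineC
    (t : ↥(Literature.NumberTheory.Automorphic.relNormOneInfUnits (↥(maximalRealSubfield L)) L)) :
    ((lineCharV_zero V c.D hGR hGR₀ hGR₁ η₀ (CMCenter (L : Type) (frameD V) ((UnitaryGroup.cmAdelicOneEquivRelNormOne (L : Type)).symm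
        (Literature.NumberTheory.Automorphic.relNormOneInfToIdeles (↥(maximalRealSubfield L)) L t))) : ℂˣ) : ℂ) *
      lineC V (dW c.D 0) (dW_real c.D 0) (dW_ne c.D 0) hGR₀ t = 1 := by
  have h := lineCharV_zero_smul_cmArchCenter_blockFamilyOfAt V c hGR hGR₀ hGR₁ η₀ h₁W hemb eR eS hχ a hω hdef t
    (dotProductEquiv ℂ (Fin 2) (Pi.single 0 1))
  rw [cmArchWeilRep_center_blockFamilyOfAt, smul_smul] at h
  exact smul_cancel_of_ne_zero (blockFamilyOfAt_degOnePDual_binvPi_one_ne_zero Empty (L : Type) e₁ (frameD V) (frameD_real V) (frameD_ne V)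
    (lineVec (L : Type) (dW c.D 0)) (fun _ => dW_real c.D 0) (fun _ => dW_ne c.D 0) ι₁ (blockPosEquiv V) (blockNegEquiv V) eR eS)
    (h.trans (one_smul ℂ _).symm)

end Zero

/-! ##### slot 1 -/

section One

variable
  (eR : PosIdx (cmXW (L : Type) (frameD V) (lineVec (L : Type) (dW c.D 1)) (fun _ => dW_real c.D 1) ι₁ (HypCensus.cmPlace (L : Type) ι₁)) ≃ Unit)
  (eS : NegIdx (cmXW (L : Type) (frameD V) (lineVec (L : Type) (dW c.D 1)) (fun _ => dW_real c.D 1) ι₁ (HypCensus.cmPlace (L : Type) ι₁)) ≃ Empty)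
  (hχ : ∀ u : stabilizer U21 x₀,
    ((lineScalar_one V c.D hGR hGR₀ hGR₁ η₁ (u : U21) : ℂˣ) : ℂ) *
        ((matA (stabilizerEquivK21.symm u)).det ^ (lineVacExponentsOne V c hGR₁ h₁W eR eS).eP *
          sclD (stabilizerEquivK21.symm u) ^ (lineVacExponentsOne V c hGR₁ h₁W eR eS).eQ) =
      star (sclD (stabilizerEquivK21.symm u)))
  (a : {v : InfinitePlace ↥(maximalRealSubfield L) // v.IsReal} → ℤ)
  (hω : ∀ b : {v : InfinitePlace ↥(maximalRealSubfield L) // v.IsReal}, b ≠ HypCensus.cmPlace (L : Type) ι₁ →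
    ∀ (u : UnitaryGroup.archLocal (L : Type) 3 (Matrix.diagonal (frameD V)) (cmPlaceOver (L : Type) b)) (ℓ : Module.Dual ℂ (Fin 2 → ℂ)),
      cmArchWeilRep (L : Type) e₁ (frameD V) (frameD_real V) (frameD_ne V) (lineVec (L : Type) (dW c.D 1)) (fun _ => dW_real c.D 1)
          (fun _ => dW_ne c.D 1) hGR₁
          (UnitaryGroup.archSingle (↥(maximalRealSubfield L)) L (IsCMField.complexConj L) 3 (Matrix.diagonal (frameD V))
            (IsCMField.complexConj_ne_one L) (NumberField.complexConj_smul_infinitePlace (L : Type)) (cmPlaceOver (L : Type) b) u, 1)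
          (blockFamilyOfAt (L : Type) e₁ (frameD V) (frameD_real V) (frameD_ne V) (lineVec (L : Type) (dW c.D 1)) (fun _ => dW_real c.D 1)
            (fun _ => dW_ne c.D 1) ι₁ (blockPosEquiv V) (blockNegEquiv V) eR eS (degOnePDual Empty) (binvPi 1) ℓ) =
        (((u : UnitaryGroup.archLocal (L : Type) 3 (Matrix.diagonal (frameD V)) (cmPlaceOver (L : Type) b)) : GL (Fin 3) ℂ) :
            Matrix (Fin 3) (Fin 3) ℂ).det ^ a b •
          blockFamilyOfAt (L : Type) e₁ (frameD V) (frameD_real V) (frameD_ne V) (lineVec (L : Type) (dW c.D 1)) (fun _ => dW_real c.D 1)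
            (fun _ => dW_ne c.D 1) ι₁ (blockPosEquiv V) (blockNegEquiv V) eR eS (degOnePDual Empty) (binvPi 1) ℓ)
  (hdef : ∀ b : {v : InfinitePlace ↥(maximalRealSubfield L) // v.IsReal}, b ≠ HypCensus.cmPlace (L : Type) ι₁ →
    ∀ u : UnitaryGroup.archLocal (L : Type) 3 (Matrix.diagonal (frameD V)) (cmPlaceOver (L : Type) b),
      ((archScalar_oneG V c.D hGR hGR₀ hGR₁ η₁
          (UnitaryGroup.archSingle (↥(maximalRealSubfield L)) L (IsCMField.complexConj L) 3 (Matrix.diagonal (frameD V))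
            (IsCMField.complexConj_ne_one L) (NumberField.complexConj_smul_infinitePlace (L : Type)) (cmPlaceOver (L : Type) b) u) : ℂˣ) : ℂ) *
        (((u : UnitaryGroup.archLocal (L : Type) 3 (Matrix.diagonal (frameD V)) (cmPlaceOver (L : Type) b)) : GL (Fin 3) ℂ) :
            Matrix (Fin 3) (Fin 3) ℂ).det ^ a b = 1)

include hω hdef in
/-- the AWAY factor of the centre fixes every member of the line-1 slot family under `c₁ • ω_∞,1` ((c5), #CA20's place induction). -/
theorem archScalar_oneG_smul_centerAway_blockFamilyOfAt
    (t : ↥(Literature.NumberTheory.Automorphic.relNormOneInfUnits (↥(maximalRealSubfield L)) L)) (ℓ : Module.Dual ℂ (Fin 2 → ℂ)) :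
    ((archScalar_oneG V c.D hGR hGR₀ hGR₁ η₁ (centerAway V t) : ℂˣ) : ℂ) •
        cmArchWeilRep (L : Type) e₁ (frameD V) (frameD_real V) (frameD_ne V) (lineVec (L : Type) (dW c.D 1)) (fun _ => dW_real c.D 1)
          (fun _ => dW_ne c.D 1) hGR₁ (centerAway V t, 1)
          (blockFamilyOfAt (L : Type) e₁ (frameD V) (frameD_real V) (frameD_ne V) (lineVec (L : Type) (dW c.D 1)) (fun _ => dW_real c.D 1)
            (fun _ => dW_ne c.D 1) ι₁ (blockPosEquiv V) (blockNegEquiv V) eR eS (degOnePDual Empty) (binvPi 1) ℓ) =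
      blockFamilyOfAt (L : Type) e₁ (frameD V) (frameD_real V) (frameD_ne V) (lineVec (L : Type) (dW c.D 1)) (fun _ => dW_real c.D 1)
        (fun _ => dW_ne c.D 1) ι₁ (blockPosEquiv V) (blockNegEquiv V) eR eS (degOnePDual Empty) (binvPi 1) ℓ := by
  have h := smul_apply_eq_self_of_places (L : Type) (Matrix.diagonal (frameD V))
    ((cmArchWeilRep (L : Type) e₁ (frameD V) (frameD_real V) (frameD_ne V) (lineVec (L : Type) (dW c.D 1)) (fun _ => dW_real c.D 1)
      (fun _ => dW_ne c.D 1) hGR₁).comp (MonoidHom.inl _ _))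
    (archScalar_oneG V c.D hGR hGR₀ hGR₁ η₁)
    (blockFamilyOfAt (L : Type) e₁ (frameD V) (frameD_real V) (frameD_ne V) (lineVec (L : Type) (dW c.D 1)) (fun _ => dW_real c.D 1)
      (fun _ => dW_ne c.D 1) ι₁ (blockPosEquiv V) (blockNegEquiv V) eR eS (degOnePDual Empty) (binvPi 1) ℓ)
    (UnitaryGroup.cmPlace (L : Type) ι₁) (fun b hb u => by
      rw [MonoidHom.comp_apply, MonoidHom.inl_apply, hω b (ne_cmPlace_of_cmPlaceOver_ne hb) u ℓ, smul_smul,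
        hdef b (ne_cmPlace_of_cmPlaceOver_ne hb) u, one_smul])
    (centerAway V t) (archAt_centerAway V t)
  rw [MonoidHom.comp_apply, MonoidHom.inl_apply] at h
  exact h

include hemb hχ in
/-- the `ι₁`-SECTION factor of the centre fixes every member of the line-1 slot family under `c₁ • ω_∞,1` (`harm` at the CENTRAL element
`z_t · 1 ∈ K`, `τ₁^∨(z · 1) = id`). -/
theorem lineScalar_one_smul_centerK_blockFamilyOfAt
    (t : ↥(Literature.NumberTheory.Automorphic.relNormOneInfUnits (↥(maximalRealSubfield L)) L)) (ℓ : Module.Dual ℂ (Fin 2 → ℂ)) :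
    ((lineScalar_one V c.D hGR hGR₀ hGR₁ η₁ ((centerK (L : Type) ι₁ t : stabilizer U21 x₀) : U21) : ℂˣ) : ℂ) •
        cmArchWeilRep (L : Type) e₁ (frameD V) (frameD_real V) (frameD_ne V) (lineVec (L : Type) (dW c.D 1)) (fun _ => dW_real c.D 1)
          (fun _ => dW_ne c.D 1) hGR₁ (archSectionFrameOf V ((centerK (L : Type) ι₁ t : stabilizer U21 x₀) : U21), 1)
          (blockFamilyOfAt (L : Type) e₁ (frameD V) (frameD_real V) (frameD_ne V) (lineVec (L : Type) (dW c.D 1)) (fun _ => dW_real c.D 1)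
            (fun _ => dW_ne c.D 1) ι₁ (blockPosEquiv V) (blockNegEquiv V) eR eS (degOnePDual Empty) (binvPi 1) ℓ) =
      blockFamilyOfAt (L : Type) e₁ (frameD V) (frameD_real V) (frameD_ne V) (lineVec (L : Type) (dW c.D 1)) (fun _ => dW_real c.D 1)
        (fun _ => dW_ne c.D 1) ι₁ (blockPosEquiv V) (blockNegEquiv V) eR eS (degOnePDual Empty) (binvPi 1) ℓ := by
  have hv := harm_lineOmega_oneG V c hGR hGR₀ hGR₁ η₁ h₁W (binvPi 1) hemb eR eS hχ (centerK (L : Type) ι₁ t) ℓ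
  rw [centerK_def, weightOf_dual_blockK_centralK, ← centerK_def, lineOmega_one, Representation.smulPull_apply] at hv
  exact hv

include hemb hχ hω hdef in
/-- **(CF₁) on the slot family**: the archimedean CENTRE `t · 1_V` in the `U(V)`-slot of line 1 fixes every member `Φ_∞,1(ℓ)`:
`lineCharV_1(u_t · 1_V) • ω_∞,1(t · 1₃, 1) Φ_∞,1(ℓ) = Φ_∞,1(ℓ)`. -/
theorem lineCharV_one_smul_cmArchCenter_blockFamilyOfAt
    (t : ↥(Literature.NumberTheory.Automorphic.relNormOneInfUnits (↥(maximalRealSubfield L)) L)) (ℓ : Module.Dual ℂ (Fin 2 → ℂ)) :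
    ((lineCharV_one V c.D hGR hGR₀ hGR₁ η₁ (CMCenter (L : Type) (frameD V) ((UnitaryGroup.cmAdelicOneEquivRelNormOne (L : Type)).symm
        (Literature.NumberTheory.Automorphic.relNormOneInfToIdeles (↥(maximalRealSubfield L)) L t))) : ℂˣ) : ℂ) •
        cmArchWeilRep (L : Type) e₁ (frameD V) (frameD_real V) (frameD_ne V) (lineVec (L : Type) (dW c.D 1)) (fun _ => dW_real c.D 1)
          (fun _ => dW_ne c.D 1) hGR₁ (cmArchCenter (L : Type) 3 (Matrix.diagonal (frameD V)) t, 1)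
          (blockFamilyOfAt (L : Type) e₁ (frameD V) (frameD_real V) (frameD_ne V) (lineVec (L : Type) (dW c.D 1)) (fun _ => dW_real c.D 1)
            (fun _ => dW_ne c.D 1) ι₁ (blockPosEquiv V) (blockNegEquiv V) eR eS (degOnePDual Empty) (binvPi 1) ℓ) =
      blockFamilyOfAt (L : Type) e₁ (frameD V) (frameD_real V) (frameD_ne V) (lineVec (L : Type) (dW c.D 1)) (fun _ => dW_real c.D 1)
        (fun _ => dW_ne c.D 1) ι₁ (blockPosEquiv V) (blockNegEquiv V) eR eS (degOnePDual Empty) (binvPi 1) ℓ := by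
  rw [← archToAdelic_cmArchCenter_frameD, ← archScalar_oneG_eq_lineCharV, cmArchCenter_eq_archSectionFrameOf_mul_centerAway V t,
    map_mul, Units.val_mul,
    show ((archSectionFrameOf V ((centerK (L : Type) ι₁ t : stabilizer U21 x₀) : U21) * centerAway V t,
        (1 : UnitaryGroup.arch (↥(maximalRealSubfield L)) L (IsCMField.complexConj L) 1 (Matrix.diagonal (lineVec (L : Type) (dW c.D 1))))) :
        UnitaryGroup.arch (↥(maximalRealSubfield L)) L (IsCMField.complexConj L) 3 (Matrix.diagonal (frameD V)) ×
          UnitaryGroup.arch (↥(maximalRealSubfield L)) L (IsCMField.complexConj L) 1 (Matrix.diagonal (lineVec (L : Type) (dW c.D 1)))) =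
      (archSectionFrameOf V ((centerK (L : Type) ι₁ t : stabilizer U21 x₀) : U21), 1) * (centerAway V t, 1) by rw [Prod.mk_mul_mk, mul_one],
    map_mul, Module.End.mul_apply, mul_smul, ← map_smul, archScalar_oneG_smul_centerAway_blockFamilyOfAt V c hGR hGR₀ hGR₁ η₁ eR eS a hω hdef]
  exact lineScalar_one_smul_centerK_blockFamilyOfAt V c hGR hGR₀ hGR₁ η₁ h₁W hemb eR eS hχ t ℓ

include hemb hχ hω hdef in
/-- **(CF₁) on thin-coset test functions**: `lineCharV_1(u_t·1_V) • ω₁(u_t·1_V, 1) φ_N(Φ_∞,1(ℓ)) = φ_N(Φ_∞,1(ℓ))` at every base point and level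
(the hypothesis `hfix` of `w_mul_lineCharV_one_eq_torusScalar`, DISCHARGED for the harmonic family). -/
theorem lineCharV_one_smul_cmPairRep_center_testFun
    (t : ↥(Literature.NumberTheory.Automorphic.relNormOneInfUnits (↥(maximalRealSubfield L)) L)) (ℓ : Module.Dual ℂ (Fin 2 → ℂ))
    (x : Fin 3 → ↥(maximalRealSubfield L)) (N : ℕ) :
    ((lineCharV_one V c.D hGR hGR₀ hGR₁ η₁ (CMCenter (L : Type) (frameD V) ((UnitaryGroup.cmAdelicOneEquivRelNormOne (L : Type)).symm
        (Literature.NumberTheory.Automorphic.relNormOneInfToIdeles (↥(maximalRealSubfield L)) L t))) : ℂˣ) : ℂ) •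
        cmPairRep (L : Type) e₁ (frameD V) (frameD_real V) (frameD_ne V) (lineVec (L : Type) (dW c.D 1)) (fun _ => dW_real c.D 1)
          (fun _ => dW_ne c.D 1) hGR₁
          (CMCenter (L : Type) (frameD V) ((UnitaryGroup.cmAdelicOneEquivRelNormOne (L : Type)).symm
            (Literature.NumberTheory.Automorphic.relNormOneInfToIdeles (↥(maximalRealSubfield L)) L t)), 1)
          (SupplyInstance.testFun (↥(maximalRealSubfield L)) (Fin 3)
            (blockFamilyOfAt (L : Type) e₁ (frameD V) (frameD_real V) (frameD_ne V) (lineVec (L : Type) (dW c.D 1)) (fun _ => dW_real c.D 1)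
              (fun _ => dW_ne c.D 1) ι₁ (blockPosEquiv V) (blockNegEquiv V) eR eS (degOnePDual Empty) (binvPi 1) ℓ) x N) =
      SupplyInstance.testFun (↥(maximalRealSubfield L)) (Fin 3)
        (blockFamilyOfAt (L : Type) e₁ (frameD V) (frameD_real V) (frameD_ne V) (lineVec (L : Type) (dW c.D 1)) (fun _ => dW_real c.D 1)
          (fun _ => dW_ne c.D 1) ι₁ (blockPosEquiv V) (blockNegEquiv V) eR eS (degOnePDual Empty) (binvPi 1) ℓ) x N := by
  rw [cmPairRep_cmCenter_inf_one_testFun, ← testFun_smul,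
    lineCharV_one_smul_cmArchCenter_blockFamilyOfAt V c hGR hGR₀ hGR₁ η₁ h₁W hemb eR eS hχ a hω hdef]

include hemb hχ hω hdef in
/-- **(Hw₁′) DISCHARGED for an archimedean input pinned on the harmonic family**: for ANY four `η`'s, ANY conjugated-plane splittings and
ANY `A : ArchLineInput V (lineRepOf … 1)` with `A.Φinf = Φ_∞,1(ℓ₀)`:  `A.w t · lineCharV_1 (u_t · 1_V) = torusScalar_1 (u_t)` for every `t`.
At `η₁ := eta₁ V c.D η` (default split, `archSideOf`) `lineCharV_one = 1` (#CA21: `eta₁_apply_mk_one`, `cmLineChar₁_apply_mk_one`) and this is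
#1260's UNTWISTED `hw`; at `η₁ := etaT₁ V c.D η ν` (the pins `archSideOfT`/`archSideOfT'` of record) `lineCharV_one = ν`, and slot 1 needs the
`ν`-twisted dictionary record (sinst-1's #1256 pattern with `ĉ₁ := bigCharOfV (lineCharV_one …)`). -/
theorem w_mul_lineCharV_one_eq_torusScalar_of_eq_blockFamilyOfAt
    (hGR₂ : (cmSplittingDatum (L : Type) (e₁) (frameD V) (frameD_real V) (frameD_ne V) (lineVec (L : Type) (dW' c.D 0))
      (fun _ => dW'_real c.D 0) (fun _ => dW'_ne c.D 0)).CompatibleSplitting)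
    (hGR₃ : (cmSplittingDatum (L : Type) (e₁) (frameD V) (frameD_real V) (frameD_ne V) (lineVec (L : Type) (dW' c.D 1))
      (fun _ => dW'_real c.D 1) (fun _ => dW'_ne c.D 1)).CompatibleSplitting)
    (η₂ η₃ : CMAdelic (L : Type) (frameD V) × CMAdelicOne (L : Type) →* ℂˣ)
    (A : ArchLineInput V (lineRepOf V c.D hGR hGR₀ hGR₁ hGR₂ hGR₃ η₀ η₁ η₂ η₃ 1)) {ℓ₀ : Module.Dual ℂ (Fin 2 → ℂ)}
    (hΦ : A.Φinf = blockFamilyOfAt (L : Type) e₁ (frameD V) (frameD_real V) (frameD_ne V) (lineVec (L : Type) (dW c.D 1)) (fun _ => dW_real c.D 1)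
      (fun _ => dW_ne c.D 1) ι₁ (blockPosEquiv V) (blockNegEquiv V) eR eS (degOnePDual Empty) (binvPi 1) ℓ₀)
    (t : ↥(Literature.NumberTheory.Automorphic.relNormOneInfUnits (↥(maximalRealSubfield L)) L)) :
    A.w t * ((lineCharV_one V c.D hGR hGR₀ hGR₁ η₁ (CMCenter (L : Type) (frameD V)
          ((UnitaryGroup.cmAdelicOneEquivRelNormOne (L : Type)).symm
            (Literature.NumberTheory.Automorphic.relNormOneInfToIdeles (↥(maximalRealSubfield L)) L t))) : ℂˣ) : ℂ) =
      ((torusScalar_oneG V c.D hGR hGR₀ hGR₁ η₁ ((UnitaryGroup.cmAdelicOneEquivRelNormOne (L : Type)).symm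
            (Literature.NumberTheory.Automorphic.relNormOneInfToIdeles (↥(maximalRealSubfield L)) L t)) : ℂˣ) : ℂ) :=
  by
  have hfix := lineCharV_one_smul_cmPairRep_center_testFun V c hGR hGR₀ hGR₁ η₁ h₁W hemb eR eS hχ a hω hdef t ℓ₀ A.x₀ 1
  rw [← hΦ] at hfix
  exact w_mul_lineCharV_one_eq_torusScalar V c.D hGR hGR₀ hGR₁ hGR₂ hGR₃ η₀ η₁ η₂ η₃ A t one_ne_zero hfix

include hemb hχ hω hdef in
/-- **(CC₁) the character identity of the centre**: `lineCharV_1(u_t · 1_V) · c₁(t) = 1` with theta-3's centre eigenvalue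
`c₁ = lineC … hGR₁ = lineCenterChar · archPlaceChar_(w(ι₁))` (#CA60 `cmArchWeilRep_center_blockFamilyOfAt`): on the archimedean centre the
`V`-twist of line 1 is the INVERSE of the central character of the untwisted `ω_∞,1` on the harmonic vector — the one sentence behind BOTH the
index-side `hμ` (theta-3's `centralTypeOf` ∕ #S19 `centerCharInf`) and the automorphy-side `hw` ((Hw₁′)). -/
theorem lineCharV_one_center_mul_lineC
    (t : ↥(Literature.NumberTheory.Automorphic.relNormOneInfUnits (↥(maximalRealSubfield L)) L)) :
    ((lineCharV_one V c.D hGR hGR₀ hGR₁ η₁ (CMCenter (L : Type) (frameD V) ((UnitaryGroup.cmAdelicOneEquivRelNormOne (L : Type)).symm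
        (Literature.NumberTheory.Automorphic.relNormOneInfToIdeles (↥(maximalRealSubfield L)) L t))) : ℂˣ) : ℂ) *
      lineC V (dW c.D 1) (dW_real c.D 1) (dW_ne c.D 1) hGR₁ t = 1 := by
  have h := lineCharV_one_smul_cmArchCenter_blockFamilyOfAt V c hGR hGR₀ hGR₁ η₁ h₁W hemb eR eS hχ a hω hdef t
    (dotProductEquiv ℂ (Fin 2) (Pi.single 0 1))
  rw [cmArchWeilRep_center_blockFamilyOfAt, smul_smul] at h
  exact smul_cancel_of_ne_zero (blockFamilyOfAt_degOnePDual_binvPi_one_ne_zero Empty (L : Type) e₁ (frameD V) (frameD_real V) (frameD_ne V)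
    (lineVec (L : Type) (dW c.D 1)) (fun _ => dW_real c.D 1) (fun _ => dW_ne c.D 1) ι₁ (blockPosEquiv V) (blockNegEquiv V) eR eS)
    (h.trans (one_smul ℂ _).symm)

end One

end Honest

end HodgeCM.Model.ArchSideTerm

end
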